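import Literature.NumberTheory.Automorphic.PairLFunctionPolesChangeOfS
import Literature.NumberTheory.Automorphic.PairLFunctionPolesRankNeAssembly
import Literature.NumberTheory.Automorphic.JacquetShalikaEulerProducts
import Literature.NumberTheory.Automorphic.RankinSelbergTowerFiniteness
import HarnessLib

/-!
# Arthur–Clozel (2.3), the pole of `L^S(s, π ⊗ π̃)` at `s = 1`: change of `S` and the one-family form

Topic `NumberTheory/Automorphic`; namespace `Literature.NumberTheory.Automorphic`. Proof file
(theorems only: no definition, no named fact, no instance) under the named fact
`JacquetShalika1981_partialPairL_pole_of_eq_conj` of `PairLFunctionPoles` — Arthur–Clozel,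
*Simple algebras, base change, and the advanced theory of the trace formula*, Ann. of Math.
Stud. 120 (1989), Ch. 3 §2, (2.3), p. 171 of the held copy: for unitary cuspidal `π ≅ σ̃` on
`GL_n(𝔸_K)` (rendered `P = P'.conj`), "the limit `lim_{s → 1, Re s > 1} (s - 1) L^S(s, π ⊗ σ)`
exists and is finite and non-zero" — for **every** finite set `S` of finite places off which `π`,
`σ` are unramified and **every** pair of Satake families `α`, `β` of `π`, `σ` off `S`.

This is the companion for (2.3) of `PairLFunctionPolesNeConjOneFamily` ((2.2) at `s = 1`,
`π ≇ σ̃`) and `PairLFunctionPolesChangeOfS` ((2.2) at `s = 1`, `n ≠ m`), whose bookkeeping it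
reuses verbatim with the weight `w(s) = s - 1`: the printed sources (Jacquet–Shalika II,
Prop. 3.6; Jacquet–Shalika I, (5.1), p. 554: "`S` … large enough"; Cogdell (2004), §4.2) prove the
pole statement for **one** finite set of places containing the bad ones and for the canonical
classes `A_v`, `Ā_v` of `σ`, `σ̄ ≅ σ̃`; passing to an arbitrary admissible `S` moves finitely many
unramified Euler factors `L_v(s) = det(1 - Ā_v ⊗ A_v q_v^{-s})⁻¹`, continuous and non-zero at
`s₀ = 1` because no product `ā a'` of Satake parameters equals `q_v` — Jacquet–Shalika's
**strict** bound `|a| < q_v^{1/2}` (loc. cit. Cor. (2.5), p. 515),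
`eval_satakePairPolynomial_ne_zero_of_lt_sqrt` — and replaces the families by any other Satake
families of the same representations (uniqueness of Hecke–Satake parameters,
`partialPairL_eq_of_isSatakeFamilyOf`).

* `JacquetShalika1981_partialPairL_pole_of_eq_conj_of_one_family` (**main**) — the named fact
  from: (2.1) `JacquetShalika1981_multipliable_partialPairL` at `(n, n)`, the strict bound for the
  Satake families of cuspidal representations of `GL_n(𝔸_K)`, and **one** datum per cuspidal `σ`
  (`P'`): a finite `S₀`, a Satake family `β₀` of `σ` off `S₀` and a finite non-zero limit of
  `(s - 1) L^{S₀}(s, β̄₀ ⊗ β₀)` at `1` from `Re s > 1` (what the global Rankin–Selberg method for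
  `(σ̄, σ)` delivers: `RankinSelbergResidueDatum`, `WhittakerTowerParseval`);
  `…_of_one_family'` accepts the datum in the order `L^{S₀}(s, β₀ ⊗ β̄₀)` of
  `JacquetShalika1981_continuation_partialPairL_conj` (`partialPairL_comm`);
* `JacquetShalika1981_partialPairL_pole_of_eq_conj_iff_one_family` — tightness: under the same
  standing inputs the fact is *equivalent* to its one-family form;
* `JacquetShalika1981_partialPairL_pole_of_eq_conj_of_one_family_of_normLt` — (2.1) discharged by
  `JacquetShalika1981_multipliable_partialPairL_holds` and the strict bound fed from Jacquet–Shalika's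
  local Cor. (2.5) alone (`norm_satakeParameter_lt_sqrt_of_normLt`: local components, their
  genericity and Flath's dictionary being theorems of the tree);
* `JacquetShalika1981_partialPairL_pole_of_eq_conj_of_one_family_of_le_two` — in ranks `n ≤ 2`,
  where Cor. (2.5) is a theorem of the tree (`norm_satakeParameter_lt_sqrt_of_le_two`), the named
  fact follows from the one-family datum **alone**.

## References

* J. Arthur, L. Clozel, *Simple algebras, base change, and the advanced theory of the trace
  formula*, Ann. of Math. Stud. 120 (1989), Ch. 3 §2, (2.1)–(2.3), p. 171. [ArthurClozelAMS120]
* H. Jacquet, J. A. Shalika, *On Euler products and the classification of automorphic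
  representations I*, Amer. J. Math. 103 (1981), 499–558: Cor. (2.5) p. 515, (5.1) p. 554,
  Thm. (5.3). [JacquetShalikaAJM1981]
* H. Jacquet, J. A. Shalika, *On Euler products and the classification of automorphic forms II*,
  Amer. J. Math. 103 (1981), 777–815, Prop. 3.6. [JacquetShalikaAJM1981II]
* J. W. Cogdell, *Analytic theory of `L`-functions for `GL_n`*, in *An Introduction to the
  Langlands Program* (2004), §4.2, Thm. 4.2 (PDF pp. 202–203 of the held copy).
  [CogdellAnalyticTheory2004]
-/

noncomputable section

open scoped MatrixGroups Topology ComplexConjugate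
open NumberField IsDedekindDomain MeasureTheory Filter Polynomial Complex

namespace Literature.NumberTheory.Automorphic

open AdelicGroupData

section OneFamily

variable {n : ℕ} {K : Type} [Field K] [NumberField K]
  {μ : Measure (gl n K).automorphicQuotient} [(gl n K).IsAutomorphicMeasure μ]

/-- **Arthur–Clozel (2.3) from its one-family form.** Standing inputs, all statements of the tree:
(2.1) `JacquetShalika1981_multipliable_partialPairL` at `(n, n)` (Jacquet–Shalika (1981), Thm. (5.3),
a theorem of the tree: `JacquetShalika1981_multipliable_partialPairL_holds`); the strict bound
`|a| < q_v^{1/2}` for the Satake families of cuspidal representations of `GL_n(𝔸_K)` (loc. cit.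
Cor. (2.5)). Then the named fact `JacquetShalika1981_partialPairL_pole_of_eq_conj` — for **all**
`π = σ̄`, **all** finite `S` and **all** Satake families `α`, `β` of `π`, `σ` off `S` — follows from
**one** datum per cuspidal `σ` (`n ≥ 1`): a finite `S₀`, a Satake family `β₀` of `σ` off `S₀`, and a
finite non-zero limit of `(s - 1) L^{S₀}(s, β̄₀ ⊗ β₀)` at `1` from `Re s > 1` (`β̄₀ = conjFamily β₀`
is a Satake family of `σ̄`, `IsSatakeFamilyOf.conj`; this is what Jacquet–Shalika II, Prop. 3.6
delivers for `S` "large enough" and the canonical classes). Proof: transfer up `S₀ ↑ S ∪ S₀`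
(`exists_ne_zero_tendsto_mul_partialPairL_of_supset`, weight `w(s) = s - 1`),
`L^{S ∪ S₀}(α ⊗ β) = L^{S ∪ S₀}(β̄₀ ⊗ β₀)` (uniqueness of Hecke–Satake parameters,
`partialPairL_eq_of_isSatakeFamilyOf`), transfer down `S ∪ S₀ ↓ S`
(`exists_ne_zero_tendsto_mul_partialPairL_of_subset`); the factors moved are unramified for both `σ̄`
and `σ`, so `det(1 - Ā_v ⊗ A_v q_v^{-1}) ≠ 0` by `eval_satakePairPolynomial_ne_zero_of_lt_sqrt`.
[cite: ArthurClozelAMS120, Ch. 3 §2 (2.3)] -/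
theorem JacquetShalika1981_partialPairL_pole_of_eq_conj_of_one_family
    (h21 : JacquetShalika1981_multipliable_partialPairL (n := n) (m := n) (K := K) (μ := μ)
      (μ' := μ))
    (hlt : ∀ (P : CuspidalAutomorphicRepGL n K μ) {S : Set (HeightOneSpectrum (𝓞 K))}
      {α : SatakeFamily K} (_hα : IsSatakeFamilyOf P S α) {v : HeightOneSpectrum (𝓞 K)}
      (_hv : v ∉ S) {a : ℂ} (_ha : a ∈ α v), ‖a‖ < Real.sqrt v.residueCard)
    (hone : ∀ (_hn : 0 < n) (P' : CuspidalAutomorphicRepGL n K μ),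
      ∃ (S₀ : Set (HeightOneSpectrum (𝓞 K))) (β₀ : SatakeFamily K), S₀.Finite ∧
        IsSatakeFamilyOf P' S₀ β₀ ∧
        ∃ c : ℂ, c ≠ 0 ∧ Tendsto (fun s => (s - 1) * partialPairL S₀ (conjFamily β₀) β₀ s)
          (𝓝[{s : ℂ | 1 < s.re}] 1) (𝓝 c)) :
    JacquetShalika1981_partialPairL_pole_of_eq_conj (n := n) (K := K) (μ := μ) := by
  intro hn P P' he S hS α β hα hβ
  subst he
  obtain ⟨S₀, β₀, hS₀, hβ₀, hlim⟩ := hone hn P'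
  -- `β̄₀` is a Satake family of `σ̄` off `S₀`
  have hα₀ : IsSatakeFamilyOf P'.conj S₀ (conjFamily β₀) := hβ₀.conj
  -- non-vanishing of an unramified factor at `s₀ = 1`
  have hne : ∀ {T : Set (HeightOneSpectrum (𝓞 K))} {γ δ : SatakeFamily K}
      (_hγ : IsSatakeFamilyOf P'.conj T γ) (_hδ : IsSatakeFamilyOf P' T δ)
      {v : HeightOneSpectrum (𝓞 K)} (_hv : v ∉ T),
      (satakePairPolynomial (γ v) (δ v)).eval ((v.residueCard : ℂ) ^ (-(1 : ℂ))) ≠ 0 :=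
    fun hγ hδ v hv => eval_satakePairPolynomial_ne_zero_of_lt_sqrt v.one_lt_residueCard
      (fun a ha => hlt _ hγ hv ha) (fun b hb => (hlt _ hδ hv hb).le) Complex.one_re
  have hT : ((S ∪ S₀) \ S₀).Finite := (hS.union hS₀).subset fun v hv => hv.1
  have hT' : ((S ∪ S₀) \ S).Finite := (hS.union hS₀).subset fun v hv => hv.1
  -- up from `S₀` to `S ∪ S₀` with the families `β̄₀`, `β₀`
  have h1 : ∃ c : ℂ, c ≠ 0 ∧
      Tendsto (fun s => (s - 1) * partialPairL (S ∪ S₀) (conjFamily β₀) β₀ s)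
        (𝓝[{s : ℂ | 1 < s.re}] 1) (𝓝 c) :=
    exists_ne_zero_tendsto_mul_partialPairL_of_supset Set.subset_union_right hT (fun s => s - 1)
      (eventually_multipliable_of_multipliable_partialPairL h21 Set.subset_union_right hα₀ hβ₀ 1)
      (fun v hv => hne hα₀ hβ₀ hv.2) hlim
  -- `α = β̄₀`, `β = β₀` off `S ∪ S₀`
  have hfam : partialPairL (S ∪ S₀) α β = partialPairL (S ∪ S₀) (conjFamily β₀) β₀ :=
    partialPairL_eq_of_isSatakeFamilyOf Set.subset_union_left Set.subset_union_right hα hβ hα₀ hβ₀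
  rw [← hfam] at h1
  -- down from `S ∪ S₀` to `S` with the families `α`, `β`
  exact exists_ne_zero_tendsto_mul_partialPairL_of_subset Set.subset_union_left hT' (fun s => s - 1)
    (eventually_multipliable_of_multipliable_partialPairL h21 Set.subset_union_left hα hβ 1)
    (fun v hv => hne hα hβ hv.2) h1

/-- The same reduction with the one-family datum given in the order `L^{S₀}(s, β₀ ⊗ β̄₀)` of
Jacquet–Shalika's Lemma (5.2) (`JacquetShalika1981_continuation_partialPairL_conj`:
`partialPairL S α (conjFamily α)`), by the symmetry `partialPairL_comm`. [folklore] -/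
theorem JacquetShalika1981_partialPairL_pole_of_eq_conj_of_one_family'
    (h21 : JacquetShalika1981_multipliable_partialPairL (n := n) (m := n) (K := K) (μ := μ)
      (μ' := μ))
    (hlt : ∀ (P : CuspidalAutomorphicRepGL n K μ) {S : Set (HeightOneSpectrum (𝓞 K))}
      {α : SatakeFamily K} (_hα : IsSatakeFamilyOf P S α) {v : HeightOneSpectrum (𝓞 K)}
      (_hv : v ∉ S) {a : ℂ} (_ha : a ∈ α v), ‖a‖ < Real.sqrt v.residueCard)
    (hone : ∀ (_hn : 0 < n) (P' : CuspidalAutomorphicRepGL n K μ),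
      ∃ (S₀ : Set (HeightOneSpectrum (𝓞 K))) (β₀ : SatakeFamily K), S₀.Finite ∧
        IsSatakeFamilyOf P' S₀ β₀ ∧
        ∃ c : ℂ, c ≠ 0 ∧ Tendsto (fun s => (s - 1) * partialPairL S₀ β₀ (conjFamily β₀) s)
          (𝓝[{s : ℂ | 1 < s.re}] 1) (𝓝 c)) :
    JacquetShalika1981_partialPairL_pole_of_eq_conj (n := n) (K := K) (μ := μ) := by
  refine JacquetShalika1981_partialPairL_pole_of_eq_conj_of_one_family h21 hlt ?_
  intro hn P'
  obtain ⟨S₀, β₀, hS₀, hβ₀, hlim⟩ := hone hn P'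
  exact ⟨S₀, β₀, hS₀, hβ₀, by rwa [partialPairL_comm S₀ β₀ (conjFamily β₀)] at hlim⟩

/-- **Tightness.** Conversely the named fact gives the one-family datum for every cuspidal `σ`
(take the finite set of ramified places and the Satake family provided by the discharged
`exists_isSatakeFamilyOf_holds`, and apply the fact to the pair `(σ̄, σ)` with the families
`(β̄₀, β₀)`), so under the standing inputs of
`JacquetShalika1981_partialPairL_pole_of_eq_conj_of_one_family` the fact is *equivalent* to its
one-family form: the reduction neither loses nor adds strength. [folklore] -/
theorem JacquetShalika1981_partialPairL_pole_of_eq_conj_iff_one_family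
    (h21 : JacquetShalika1981_multipliable_partialPairL (n := n) (m := n) (K := K) (μ := μ)
      (μ' := μ))
    (hlt : ∀ (P : CuspidalAutomorphicRepGL n K μ) {S : Set (HeightOneSpectrum (𝓞 K))}
      {α : SatakeFamily K} (_hα : IsSatakeFamilyOf P S α) {v : HeightOneSpectrum (𝓞 K)}
      (_hv : v ∉ S) {a : ℂ} (_ha : a ∈ α v), ‖a‖ < Real.sqrt v.residueCard) :
    JacquetShalika1981_partialPairL_pole_of_eq_conj (n := n) (K := K) (μ := μ) ↔
      ∀ (_hn : 0 < n) (P' : CuspidalAutomorphicRepGL n K μ),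
        ∃ (S₀ : Set (HeightOneSpectrum (𝓞 K))) (β₀ : SatakeFamily K), S₀.Finite ∧
          IsSatakeFamilyOf P' S₀ β₀ ∧
          ∃ c : ℂ, c ≠ 0 ∧ Tendsto (fun s => (s - 1) * partialPairL S₀ (conjFamily β₀) β₀ s)
            (𝓝[{s : ℂ | 1 < s.re}] 1) (𝓝 c) := by
  refine ⟨fun h hn P' => ?_, JacquetShalika1981_partialPairL_pole_of_eq_conj_of_one_family h21 hlt⟩
  obtain ⟨S₁, β₀, -, hβ₀⟩ := exists_isSatakeFamilyOf_holds (n := n) (K := K) (μ := μ) P'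
  exact ⟨↑S₁, β₀, S₁.finite_toSet, hβ₀, h hn P'.conj P' rfl S₁.finite_toSet hβ₀.conj hβ₀⟩

/-- **The named fact from its one-family form and Jacquet–Shalika's Cor. (2.5) alone.** As
`JacquetShalika1981_partialPairL_pole_of_eq_conj_of_one_family`, with (2.1) discharged by
`JacquetShalika1981_multipliable_partialPairL_holds` (`RankinSelbergTowerFiniteness`) and the strict
bound at `GL_n` fed from the local Cor. (2.5) (`JacquetShalika1981_norm_lt_sqrt_of_isGeneric` for the
completions `K_v` in rank `n`) through `norm_satakeParameter_lt_sqrt_of_normLt` — the existence of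
irreducible admissible local components, their genericity and Flath's unramified dictionary being
theorems of the tree. What then remains for `JacquetShalika1981_partialPairL_pole_of_eq_conj_holds`
is Cor. (2.5) in rank `n` and the one-family datum (the Rankin–Selberg pole for one large `S`).
[cite: ArthurClozelAMS120, Ch. 3 §2 (2.3)] -/
theorem JacquetShalika1981_partialPairL_pole_of_eq_conj_of_one_family_of_normLt
    (hB : ∀ (v : HeightOneSpectrum (𝓞 K)) {V : Type} [AddCommGroup V] [Module ℂ V]
      (ρ : Representation ℂ (GL (Fin n) (v.adicCompletion K)) V),
      JacquetShalika1981_norm_lt_sqrt_of_isGeneric ρ)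
    (hone : ∀ (_hn : 0 < n) (P' : CuspidalAutomorphicRepGL n K μ),
      ∃ (S₀ : Set (HeightOneSpectrum (𝓞 K))) (β₀ : SatakeFamily K), S₀.Finite ∧
        IsSatakeFamilyOf P' S₀ β₀ ∧
        ∃ c : ℂ, c ≠ 0 ∧ Tendsto (fun s => (s - 1) * partialPairL S₀ (conjFamily β₀) β₀ s)
          (𝓝[{s : ℂ | 1 < s.re}] 1) (𝓝 c)) :
    JacquetShalika1981_partialPairL_pole_of_eq_conj (n := n) (K := K) (μ := μ) :=
  JacquetShalika1981_partialPairL_pole_of_eq_conj_of_one_family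
    JacquetShalika1981_multipliable_partialPairL_holds
    (fun P _ _ hα _ hv _ ha => norm_satakeParameter_lt_sqrt_of_normLt hB P hα hv ha) hone

/-- **The named fact in ranks `n ≤ 2` from the one-family datum alone.** In ranks `n ≤ 2`
Jacquet–Shalika's Cor. (2.5) is a theorem of the tree (`norm_satakeParameter_lt_sqrt_of_le_two`)
and (2.1) is `JacquetShalika1981_multipliable_partialPairL_holds`, so
`JacquetShalika1981_partialPairL_pole_of_eq_conj` is exactly equivalent to the Rankin–Selberg pole
datum: for every cuspidal `σ` of `GL_n(𝔸_K)`, one finite `S₀`, one Satake family `β₀` of `σ` off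
`S₀`, and a finite non-zero limit of `(s - 1) L^{S₀}(s, β̄₀ ⊗ β₀)` at `1` from `Re s > 1`.
[cite: ArthurClozelAMS120, Ch. 3 §2 (2.3)] -/
theorem JacquetShalika1981_partialPairL_pole_of_eq_conj_of_one_family_of_le_two (h2 : n ≤ 2)
    (hone : ∀ (_hn : 0 < n) (P' : CuspidalAutomorphicRepGL n K μ),
      ∃ (S₀ : Set (HeightOneSpectrum (𝓞 K))) (β₀ : SatakeFamily K), S₀.Finite ∧
        IsSatakeFamilyOf P' S₀ β₀ ∧
        ∃ c : ℂ, c ≠ 0 ∧ Tendsto (fun s => (s - 1) * partialPairL S₀ (conjFamily β₀) β₀ s)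
          (𝓝[{s : ℂ | 1 < s.re}] 1) (𝓝 c)) :
    JacquetShalika1981_partialPairL_pole_of_eq_conj (n := n) (K := K) (μ := μ) :=
  JacquetShalika1981_partialPairL_pole_of_eq_conj_of_one_family
    JacquetShalika1981_multipliable_partialPairL_holds
    (fun P _ _ hα _ hv _ ha => norm_satakeParameter_lt_sqrt_of_le_two h2 P hα hv ha) hone

/-- Tightness in ranks `n ≤ 2`, unconditionally: the named fact is *equivalent* to its one-family
form. [folklore] -/
theorem JacquetShalika1981_partialPairL_pole_of_eq_conj_iff_one_family_of_le_two (h2 : n ≤ 2) :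
    JacquetShalika1981_partialPairL_pole_of_eq_conj (n := n) (K := K) (μ := μ) ↔
      ∀ (_hn : 0 < n) (P' : CuspidalAutomorphicRepGL n K μ),
        ∃ (S₀ : Set (HeightOneSpectrum (𝓞 K))) (β₀ : SatakeFamily K), S₀.Finite ∧
          IsSatakeFamilyOf P' S₀ β₀ ∧
          ∃ c : ℂ, c ≠ 0 ∧ Tendsto (fun s => (s - 1) * partialPairL S₀ (conjFamily β₀) β₀ s)
            (𝓝[{s : ℂ | 1 < s.re}] 1) (𝓝 c) :=
  JacquetShalika1981_partialPairL_pole_of_eq_conj_iff_one_family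
    JacquetShalika1981_multipliable_partialPairL_holds
    (fun P _ _ hα _ hv _ ha => norm_satakeParameter_lt_sqrt_of_le_two h2 P hα hv ha)

end OneFamily

end Literature.NumberTheory.Automorphic
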